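import Mathlib
import Literature.NumberTheory.Transcendental.ZagierDilogarithmConjecture
import Literature.NumberTheory.Transcendental.KZIdealTetrahedron
import HarnessLib

/-!
# `ZagierDilogarithmConjecture` (stmt-KontsevichZagierPeriods-10550) — the positivity sector

Line `kummer-clausen-linearisation`, crux `ZagierDilogarithmConjecture` (route `HyperbolicBloch`).
The one UNCONDITIONAL sector of Zagier's dilogarithm conjecture in the route's volume / `ℤ`-form:
a ONE-SIGNED integer relation `Σ nᵢ · vol T(zᵢ) = 0` (all `nᵢ ≥ 0` or all `nᵢ ≤ 0`) among ideal
tetrahedra `T(zᵢ) = (∞, 0, 1, zᵢ)`, `Im zᵢ > 0`, is trivial — every `nᵢ = 0` because each ideal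
tetrahedron has positive hyperbolic volume (`idealTetrahedronVolume_pos`; Milnor 1982, Appendix,
Lemma 2: `vol = Л(α) + Л(β) + Л(γ) > 0`) — hence `Σ nᵢ[zᵢ] = 0` lies in the relator span. No
algebraicity of the `zᵢ` is needed. This is the exact boundary of the provable: two terms of
opposite signs is already the open irrationality of a volume ratio `vol T(z₁)/vol T(z₂)`
(Neumann 1998, §1: "it is not known if a single one of them is [irrational]").

* `sum_zsmul_of_mem_closure_of_nonneg`, `sum_zsmul_of_mem_closure_of_nonpos` — Literature
  vocabulary (`idealTetrahedronVolume`, `dilogRelators`);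
* `zagierDilogarithmConjecture_oneSigned` — the same in the route's inline vocabulary (the binder
  `∀ T, (∀ z, T z = {…}) → …` of `ZagierDilogarithmConjecture`).
-/

noncomputable section

open scoped BigOperators
open Literature.NumberTheory.Transcendental

namespace Summit.KontsevichZagierPeriods.HyperbolicBloch.ZagierDilogarithm

/-- **Positivity sector, non-negative coefficients.** If `Im zᵢ > 0`, `nᵢ ≥ 0` and
`Σ nᵢ · vol T(zᵢ) = 0`, then every `nᵢ = 0` (each ideal tetrahedron has positive volume,
`idealTetrahedronVolume_pos`), so `Σ nᵢ[zᵢ] = 0` lies in the relator group: one-signed relations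
are trivially explained — no algebraicity needed. [cite: Milnor1982, Appendix, Lemma 2] -/
theorem sum_zsmul_of_mem_closure_of_nonneg {k : ℕ} (z : Fin k → ℂ) (n : Fin k → ℤ)
    (him : ∀ i, 0 < (z i).im) (hn : ∀ i, 0 ≤ n i)
    (hsum : ∑ i, (n i : ℝ) * idealTetrahedronVolume (z i) = 0) :
    (∑ i, n i • FreeAbelianGroup.of (z i)) ∈ AddSubgroup.closure dilogRelators := by
  have hterm : ∀ i ∈ Finset.univ, 0 ≤ (n i : ℝ) * idealTetrahedronVolume (z i) := fun i _ =>
    mul_nonneg (by exact_mod_cast hn i) (idealTetrahedronVolume_pos (him i)).le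
  have hzero := (Finset.sum_eq_zero_iff_of_nonneg hterm).1 hsum
  have hn0 : ∀ i, n i = 0 := fun i => by
    have h := hzero i (Finset.mem_univ i)
    rcases mul_eq_zero.1 h with h | h
    · exact_mod_cast h
    · exact absurd h (idealTetrahedronVolume_pos (him i)).ne'
  have : (∑ i, n i • FreeAbelianGroup.of (z i)) = 0 :=
    Finset.sum_eq_zero fun i _ => by rw [hn0 i, zero_smul]
  rw [this]
  exact zero_mem _

/-- **Positivity sector, non-positive coefficients** (apply the previous lemma to `−n`).
[cite: Milnor1982, Appendix, Lemma 2] -/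
theorem sum_zsmul_of_mem_closure_of_nonpos {k : ℕ} (z : Fin k → ℂ) (n : Fin k → ℤ)
    (him : ∀ i, 0 < (z i).im) (hn : ∀ i, n i ≤ 0)
    (hsum : ∑ i, (n i : ℝ) * idealTetrahedronVolume (z i) = 0) :
    (∑ i, n i • FreeAbelianGroup.of (z i)) ∈ AddSubgroup.closure dilogRelators := by
  have h := sum_zsmul_of_mem_closure_of_nonneg z (fun i => -n i) him (fun i => by simp [hn i])
    (by
      have : ∑ i, ((-n i : ℤ) : ℝ) * idealTetrahedronVolume (z i) =
          -∑ i, (n i : ℝ) * idealTetrahedronVolume (z i) := by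
        rw [← Finset.sum_neg_distrib]
        exact Finset.sum_congr rfl fun i _ => by push_cast; ring
      rw [this, hsum, neg_zero])
  have e : (∑ i, (-n i) • FreeAbelianGroup.of (z i)) = -∑ i, n i • FreeAbelianGroup.of (z i) := by
    rw [← Finset.sum_neg_distrib]
    exact Finset.sum_congr rfl fun i _ => neg_smul _ _
  rw [e] at h
  exact (neg_mem_iff (H := AddSubgroup.closure dilogRelators)).1 h

/-- **The one-signed case of the crux, in the route's inline vocabulary.** For the standard
tetrahedron family `T` and `zᵢ ∈ ℍ⁺`, a relation `Σ nᵢ ∫_{T(zᵢ)} t⁻³ = 0` with all `nᵢ ≥ 0` or all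
`nᵢ ≤ 0` has `Σ nᵢ[zᵢ]` in the relator span (indeed `= 0`). This is the sector of
`ZagierDilogarithmConjecture` decided by positivity of hyperbolic volume alone (algebraicity of
the `zᵢ` is not even needed). [cite: Milnor1982, Appendix, Lemma 2] -/
theorem zagierDilogarithmConjecture_oneSigned (T : ℂ → Set (Fin 3 → ℝ))
    (hT : ∀ z, T z = {p | 0 < p 1 ∧ z.re * p 1 < z.im * p 0 ∧ z.im * (p 0 - 1) < (z.re - 1) * p 1 ∧
      0 < p 2 ∧ 0 < z.im * (p 0 ^ 2 + p 1 ^ 2 + p 2 ^ 2 - p 0) + (z.re - Complex.normSq z) * p 1})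
    (k : ℕ) (z : Fin k → ℂ) (n : Fin k → ℤ) (him : ∀ i, 0 < (z i).im)
    (hn : (∀ i, 0 ≤ n i) ∨ (∀ i, n i ≤ 0))
    (hrel : ∑ i, (n i : ℝ) * (∫ p in T (z i), 1 / p 2 ^ 3) = 0) :
    (∑ i, n i • FreeAbelianGroup.of (z i)) ∈ AddSubgroup.closure
      ({c : FreeAbelianGroup ℂ | ∃ x y : ℂ, IsAlgebraic ℚ x ∧ IsAlgebraic ℚ y ∧ x ≠ 0 ∧ x ≠ 1 ∧
          y ≠ 0 ∧ y ≠ 1 ∧ x ≠ y ∧ c = FreeAbelianGroup.of x - FreeAbelianGroup.of y +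
            FreeAbelianGroup.of (y / x) - FreeAbelianGroup.of ((1 - x⁻¹) / (1 - y⁻¹)) +
            FreeAbelianGroup.of ((1 - x) / (1 - y))} ∪
        {c | ∃ w : ℂ, IsAlgebraic ℚ w ∧
          c = FreeAbelianGroup.of w + FreeAbelianGroup.of ((starRingEnd ℂ) w)} ∪
        {c | ∃ w : ℂ, w.im = 0 ∧ c = FreeAbelianGroup.of w}) := by
  have hT' : ∀ w, T w = idealTetrahedron w := fun w => hT w
  have hrel' : ∑ i, (n i : ℝ) * idealTetrahedronVolume (z i) = 0 := by
    simpa only [idealTetrahedronVolume, ← hT'] using hrel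
  change (∑ i, n i • FreeAbelianGroup.of (z i)) ∈ AddSubgroup.closure dilogRelators
  rcases hn with hn | hn
  · exact sum_zsmul_of_mem_closure_of_nonneg z n him hn hrel'
  · exact sum_zsmul_of_mem_closure_of_nonpos z n him hn hrel'

/-- **Registered sub-goal `stub_oneSigned` of the crux (line `kummer-clausen-linearisation`):**
the positivity sector of `ZagierDilogarithmConjecture` — one-signed relations
`Σ nᵢ ∫_{T(zᵢ)} t⁻³ = 0`, `zᵢ ∈ ℍ⁺`, are explained (indeed trivial), stated with the relator span
`AddSubgroup.closure dilogRelators`. [cite: Milnor1982, Appendix, Lemma 2] -/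
theorem stub_oneSigned :
    ∀ (T : ℂ → Set (Fin 3 → ℝ)), (∀ z, T z = {p | 0 < p 1 ∧ z.re * p 1 < z.im * p 0 ∧
      z.im * (p 0 - 1) < (z.re - 1) * p 1 ∧ 0 < p 2 ∧
      0 < z.im * (p 0 ^ 2 + p 1 ^ 2 + p 2 ^ 2 - p 0) + (z.re - Complex.normSq z) * p 1}) →
    ∀ (k : ℕ) (z : Fin k → ℂ) (n : Fin k → ℤ), (∀ i, 0 < (z i).im) →
      ((∀ i, 0 ≤ n i) ∨ (∀ i, n i ≤ 0)) →
      ∑ i, (n i : ℝ) * (∫ p in T (z i), 1 / p 2 ^ 3) = 0 →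
        (∑ i, n i • FreeAbelianGroup.of (z i)) ∈ AddSubgroup.closure dilogRelators :=
  fun T hT k z n him hn hrel => zagierDilogarithmConjecture_oneSigned T hT k z n him hn hrel

end Summit.KontsevichZagierPeriods.HyperbolicBloch.ZagierDilogarithm

end
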